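import Mathlib
import Summits.NavierStokesRegularity.NavierStokesRegularity.Theorems.RootDecompLitSliceEnergyClockLerayFloor
import HarnessLib

/-!
# Route RootDecompLitSlice — cell Uᶜ `CritTameScarIsCritical` (stmt-NavierStokesRegularity-31733):
# CLOCK RIGIDITY `b ≤ 1/2` from the mean-field one-step at a general clock exponent

Helpers toward Uᶜ (`--supports 31733`, no item, no node); sequel of `RootDecompLitSliceMeanFieldBootstrapMap`
(decomp-ns writer g43; general-`b` exponents re-derived by census g57 TREE PROBE #51 and critic rows 726/728).

THE ONE-STEP AT CLOCK EXPONENT `b` (paper-level, as in the `b = 1/2` file; `τ = T − t`,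
`D(t) = ‖u(t)‖₂² − ‖u(T)‖₂²`, clock `‖u(t)−u(T)‖₂² ≤ Kτ^b`, energy law `D ≤ Cτ^a`, proxy scale `σ = τ^μ`,
`μ ≤ 1`): `D(t) ≤ Kτ^{e0} + 2|T1| + 2|T2| + 2|T3|` with exponents
`e0 = b`, `e1 = (b/2)(1+μ)`, `e2a = (1+3a)/4 + μ(b/4 − (1−a)/2)`, `e2b = (1+a)/2 + μ(b/4 − 3(1−a)/4)`,
`e3 = (1+a)/2 − μ(1−a)/2` (`b` enters only `e0`, `e1` and the `σ^{b/4}` factor of `T2`). KERNEL CONTENT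
(def-free):

* §1 exponent algebra on the validity region `R = {1/2 ≤ b ≤ 1, b/2 ≤ a ≤ 1/2}`: the balance
  `μ⋆_b(a) = (1+3a−2b)/(2+b−2a) ∈ (0,1]`, `e1(μ⋆) = e2a(μ⋆) = Ψ_b(a) := b(3+a−b)/(2(2+b−2a))`,
  `e2b(μ⋆) − Ψ_b = (1−a)(1+3b−5a)/(4(2+b−2a)) ≥ 0`, `e3(μ⋆) − Ψ_b = ((1+b−a)² − 2b)/(2(2+b−2a)) ≥ 0`,
  GAIN `Ψ_b(a) − a = q_b(a)/(2(2+b−2a))`, `q_b(a) = 4a² − (4+b)a + b(3−b)`, and the UNIFORM GAIN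
  `Ψ_b(a) − a ≥ (b−1/2)(2−b)/(2(2+b))` for `a ≤ 1/2` (`q_b` decreasing left of `(4+b)/8 ≥ 1/2`,
  `q_b(1/2) = (b−1/2)(2−b)`);
* `step_of_termBounds_b` — the five term bounds at `μ⋆_b(a)` yield the law `min b Ψ_b(a)` (`τ ≤ 1`);
* §2 `exists_gt_half_of_uniformGain` — ABSTRACT CROSSING: base `P(b/2)`, a step `P a → P(min b (Ψ a))`
  on `[b/2, 1/2]` with uniform gain `Ψ a ≥ a + γ`, `γ > 0`, `b > 1/2` ⟹ `∃ a > 1/2, P a` (finitely many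
  steps; Archimedes);
* §3 ★ `no_clock_above_half_of_meanFieldStep` — on U's frame (maximal smooth solution, Leray–Hopf, decaying
  datum; tame at `T`): a clock of exponent `b ∈ (1/2, 1]` together with the ONE inserted antecedent — the
  mean-field one-step schema at exponent `b`, «energy law `a ∈ [b/2, 1/2]` ⟹ energy law `min b Ψ_b(a)`» — is
  CONTRADICTORY: the free law `a₀ = b/2` (`EnergyClockScarLaw.energyLaw_of_clock`) crosses `a = 1/2` after
  finitely many steps and meets Leray's floor `EnergyClockScarLaw.no_energyLaw_above_half` (Leray floor file);
  `clockExponent_le_half_of_meanFieldStep` adds the unconditional `b > 1` case (`no_clock_above_one`).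

READING (conditional on the paper-level one-step; census #51 / critic 728): the landed clock cap `b ≤ 1`
sharpens to CLOCK RIGIDITY `b ≤ 1/2` — the sub-cell `{b > 1/2}` of Uᶜ is EMPTY, the open clock window of record
`{1/2 ≤ b < 5/8}` collapses to `{b = 1/2}`, and with the `b = 1/2` bootstrap (`∀ a < 1/2`) every member of Uᶜ's
class sits at the corner `(b,a) = (1/2, 1/2⁻)` («log-burning in place»). HONEST FRAMING: helpers INSIDE the
Tao-vacuous, zero-load cell Uᶜ; no item, no node, no load moves (ROOT ⟺ Uᵃ ∧ P1). Rung 0: nothing here proves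
NS regularity. [folklore]
-/

set_option linter.dupNamespace false

namespace Summit.NavierStokesRegularity.NavierStokesRegularity.Theorems

open MeasureTheory Set Filter Topology
open scoped ENNReal
open Literature.Analysis.FluidPDE

namespace MeanFieldClockRigidity

/-! ### §1 Exponent algebra at a general clock exponent `b` -/

/-- The denominator `2 + b − 2a` is positive for `a ≤ 1/2`, `b > −1`. [folklore] -/
theorem denom_pos {a b : ℝ} (ha : a ≤ 1 / 2) (hb : 1 / 2 ≤ b) : 0 < 2 + b - 2 * a := by linarith

/-- `0 < μ⋆_b(a)` on `R` (indeed for `b/2 ≤ a ≤ 1/2`). [folklore] -/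
theorem muStar_pos {a b : ℝ} (hab : b / 2 ≤ a) (ha : a ≤ 1 / 2) (hb : 1 / 2 ≤ b) :
    0 < (1 + 3 * a - 2 * b) / (2 + b - 2 * a) :=
  div_pos (by linarith) (denom_pos ha hb)

/-- `μ⋆_b(a) ≤ 1` on `R` (the proxy scale `σ = τ^μ ≥ τ`). [folklore] -/
theorem muStar_le_one {a b : ℝ} (ha : a ≤ 1 / 2) (hb : 1 / 2 ≤ b) :
    (1 + 3 * a - 2 * b) / (2 + b - 2 * a) ≤ 1 := by
  rw [div_le_one (denom_pos ha hb)]; linarith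

/-- Balance: `e1(μ⋆_b(a)) = Ψ_b(a)`. [folklore] -/
theorem e1_eq_psi {a b : ℝ} (ha : a ≤ 1 / 2) (hb : 1 / 2 ≤ b) :
    b / 2 * (1 + (1 + 3 * a - 2 * b) / (2 + b - 2 * a)) =
      b * (3 + a - b) / (2 * (2 + b - 2 * a)) := by
  have hd := (denom_pos ha hb).ne'
  obtain ⟨i, hi⟩ : ∃ i : ℝ, i = (2 + b - 2 * a)⁻¹ := ⟨_, rfl⟩
  have hdi : (2 + b - 2 * a) * i = 1 := by rw [hi]; exact mul_inv_cancel₀ hd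
  simp only [div_eq_mul_inv, mul_inv, ← hi]
  linear_combination (-(b / 2)) * hdi

/-- Balance: `e2a(μ⋆_b(a)) = Ψ_b(a)`. [folklore] -/
theorem e2a_eq_psi {a b : ℝ} (ha : a ≤ 1 / 2) (hb : 1 / 2 ≤ b) :
    (1 + 3 * a) / 4 + (1 + 3 * a - 2 * b) / (2 + b - 2 * a) * (b / 4 - (1 - a) / 2) =
      b * (3 + a - b) / (2 * (2 + b - 2 * a)) := by
  have hd := (denom_pos ha hb).ne'
  obtain ⟨i, hi⟩ : ∃ i : ℝ, i = (2 + b - 2 * a)⁻¹ := ⟨_, rfl⟩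
  have hdi : (2 + b - 2 * a) * i = 1 := by rw [hi]; exact mul_inv_cancel₀ hd
  simp only [div_eq_mul_inv, mul_inv, ← hi]
  linear_combination (-((1 + 3 * a) / 4)) * hdi

/-- Spare exponent: `e2b(μ⋆_b(a)) − Ψ_b(a) = (1−a)(1+3b−5a)/(4(2+b−2a))`. [folklore] -/
theorem e2b_sub_psi {a b : ℝ} (ha : a ≤ 1 / 2) (hb : 1 / 2 ≤ b) :
    (1 + a) / 2 + (1 + 3 * a - 2 * b) / (2 + b - 2 * a) * (b / 4 - 3 * (1 - a) / 4) -
      b * (3 + a - b) / (2 * (2 + b - 2 * a)) = (1 - a) * (1 + 3 * b - 5 * a) / (4 * (2 + b - 2 * a)) := by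
  have hd := (denom_pos ha hb).ne'
  obtain ⟨i, hi⟩ : ∃ i : ℝ, i = (2 + b - 2 * a)⁻¹ := ⟨_, rfl⟩
  have hdi : (2 + b - 2 * a) * i = 1 := by rw [hi]; exact mul_inv_cancel₀ hd
  simp only [div_eq_mul_inv, mul_inv, ← hi]
  linear_combination (-((1 + a) / 2)) * hdi

/-- Spare exponent: `e3(μ⋆_b(a)) − Ψ_b(a) = ((1+b−a)² − 2b)/(2(2+b−2a))`. [folklore] -/
theorem e3_sub_psi {a b : ℝ} (ha : a ≤ 1 / 2) (hb : 1 / 2 ≤ b) :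
    (1 + a) / 2 - (1 + 3 * a - 2 * b) / (2 + b - 2 * a) * ((1 - a) / 2) -
      b * (3 + a - b) / (2 * (2 + b - 2 * a)) = ((1 + b - a) ^ 2 - 2 * b) / (2 * (2 + b - 2 * a)) := by
  have hd := (denom_pos ha hb).ne'
  obtain ⟨i, hi⟩ : ∃ i : ℝ, i = (2 + b - 2 * a)⁻¹ := ⟨_, rfl⟩
  have hdi : (2 + b - 2 * a) * i = 1 := by rw [hi]; exact mul_inv_cancel₀ hd
  simp only [div_eq_mul_inv, mul_inv, ← hi]
  linear_combination (-((1 + a) / 2)) * hdi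

/-- `Ψ_b ≤ e2b(μ⋆)` on `R` (`1 + 3b − 5a ≥ 0` there). [folklore] -/
theorem psi_le_e2b {a b : ℝ} (ha : a ≤ 1 / 2) (hb : 1 / 2 ≤ b) :
    b * (3 + a - b) / (2 * (2 + b - 2 * a)) ≤
      (1 + a) / 2 + (1 + 3 * a - 2 * b) / (2 + b - 2 * a) * (b / 4 - 3 * (1 - a) / 4) := by
  have h := e2b_sub_psi ha hb
  have hnn : 0 ≤ (1 - a) * (1 + 3 * b - 5 * a) / (4 * (2 + b - 2 * a)) :=
    div_nonneg (mul_nonneg (by linarith) (by linarith)) (by linarith [denom_pos ha hb])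
  linarith

/-- `Ψ_b ≤ e3(μ⋆)` on `R` (`(1+b−a)² ≥ (1/2+b)² ≥ 2b`). [folklore] -/
theorem psi_le_e3 {a b : ℝ} (ha : a ≤ 1 / 2) (hb : 1 / 2 ≤ b) :
    b * (3 + a - b) / (2 * (2 + b - 2 * a)) ≤
      (1 + a) / 2 - (1 + 3 * a - 2 * b) / (2 + b - 2 * a) * ((1 - a) / 2) := by
  have h := e3_sub_psi ha hb
  have hsq : 2 * b ≤ (1 + b - a) ^ 2 := by nlinarith [sq_nonneg (b - 1 / 2)]
  have hnn : 0 ≤ ((1 + b - a) ^ 2 - 2 * b) / (2 * (2 + b - 2 * a)) :=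
    div_nonneg (by linarith) (by linarith [denom_pos ha hb])
  linarith

/-- GAIN: `Ψ_b(a) − a = q_b(a)/(2(2+b−2a))`, `q_b(a) = 4a² − (4+b)a + b(3−b)`. [folklore] -/
theorem psi_sub_self {a b : ℝ} (ha : a ≤ 1 / 2) (hb : 1 / 2 ≤ b) :
    b * (3 + a - b) / (2 * (2 + b - 2 * a)) - a =
      (4 * a ^ 2 - (4 + b) * a + b * (3 - b)) / (2 * (2 + b - 2 * a)) := by
  have hd := (denom_pos ha hb).ne'
  obtain ⟨i, hi⟩ : ∃ i : ℝ, i = (2 + b - 2 * a)⁻¹ := ⟨_, rfl⟩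
  have hdi : (2 + b - 2 * a) * i = 1 := by rw [hi]; exact mul_inv_cancel₀ hd
  simp only [div_eq_mul_inv, mul_inv, ← hi]
  linear_combination a * hdi

/-- `q_b(a) ≥ q_b(1/2) = (b−1/2)(2−b)` for `a ≤ 1/2` (`q_b` decreases left of its vertex `(4+b)/8 ≥ 1/2`).
[folklore] -/
theorem q_ge_q_half {a b : ℝ} (ha : a ≤ 1 / 2) (hb : 0 ≤ b) :
    (b - 1 / 2) * (2 - b) ≤ 4 * a ^ 2 - (4 + b) * a + b * (3 - b) := by
  nlinarith [mul_nonneg (show 0 ≤ 1 / 2 - a by linarith) (show 0 ≤ 2 + b - 4 * a by linarith)]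

/-- ★ UNIFORM GAIN below `1/2`: for `1/2 < b ≤ 1`… in fact for `1/2 ≤ b`, `0 ≤ a ≤ 1/2`:
`Ψ_b(a) − a ≥ (b−1/2)(2−b)/(2(2+b))`. [folklore] -/
theorem uniform_gain {a b : ℝ} (ha0 : 0 ≤ a) (ha : a ≤ 1 / 2) (hb : 1 / 2 ≤ b) (hb1 : b ≤ 1) :
    a + (b - 1 / 2) * (2 - b) / (2 * (2 + b)) ≤ b * (3 + a - b) / (2 * (2 + b - 2 * a)) := by
  have hd := denom_pos ha hb
  have hgain := psi_sub_self ha hb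
  have hq := q_ge_q_half ha (by linarith : (0 : ℝ) ≤ b)
  have hqnn : 0 ≤ (b - 1 / 2) * (2 - b) := mul_nonneg (by linarith) (by linarith)
  -- `(b−1/2)(2−b)/(2(2+b)) ≤ (b−1/2)(2−b)/(2(2+b−2a)) ≤ q_b(a)/(2(2+b−2a)) = Ψ − a`
  have h1 : (b - 1 / 2) * (2 - b) / (2 * (2 + b)) ≤ (b - 1 / 2) * (2 - b) / (2 * (2 + b - 2 * a)) :=
    div_le_div_of_nonneg_left hqnn (by linarith) (by linarith)
  have h2 : (b - 1 / 2) * (2 - b) / (2 * (2 + b - 2 * a)) ≤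
      (4 * a ^ 2 - (4 + b) * a + b * (3 - b)) / (2 * (2 + b - 2 * a)) :=
    div_le_div_of_nonneg_right hq (by linarith)
  linarith

/-- ★ **One step from the term bounds at exponent `b`**: if near `T` (on `τ ≤ 1`) the energy drop obeys
`D(t) ≤ Kτ^b + A₁τ^{e1} + A₂τ^{e2a} + A₃τ^{e2b} + A₄τ^{e3}` with the exponents taken at the balance
`μ⋆_b(a)`, `a ≤ 1/2 ≤ b`, then `D(t) ≤ (K⁺+A₁⁺+A₂⁺+A₃⁺+A₄⁺)·τ^{min b Ψ_b(a)}` there. [folklore] -/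
theorem step_of_termBounds_b {T K A₁ A₂ A₃ A₄ a b T₂ : ℝ} {D : ℝ → ℝ}
    (ha : a ≤ 1 / 2) (hb : 1 / 2 ≤ b) (hT₂ : T - 1 ≤ T₂)
    (hD : ∀ t ∈ Ioo T₂ T, D t ≤ K * (T - t) ^ b +
      A₁ * (T - t) ^ (b / 2 * (1 + (1 + 3 * a - 2 * b) / (2 + b - 2 * a))) +
      A₂ * (T - t) ^ ((1 + 3 * a) / 4 + (1 + 3 * a - 2 * b) / (2 + b - 2 * a) * (b / 4 - (1 - a) / 2)) +
      A₃ * (T - t) ^ ((1 + a) / 2 + (1 + 3 * a - 2 * b) / (2 + b - 2 * a) * (b / 4 - 3 * (1 - a) / 4)) +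
      A₄ * (T - t) ^ ((1 + a) / 2 - (1 + 3 * a - 2 * b) / (2 + b - 2 * a) * ((1 - a) / 2))) :
    ∀ t ∈ Ioo T₂ T, D t ≤ (max K 0 + max A₁ 0 + max A₂ 0 + max A₃ 0 + max A₄ 0) *
      (T - t) ^ min b (b * (3 + a - b) / (2 * (2 + b - 2 * a))) := by
  intro t ht
  have hτ0 : 0 < T - t := by linarith [ht.2]
  have hτ1 : T - t ≤ 1 := by linarith [ht.1]
  -- every exponent is `≥ m := min b Ψ`
  have hm0 : min b (b * (3 + a - b) / (2 * (2 + b - 2 * a))) ≤ b := min_le_left _ _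
  have hmΨ : min b (b * (3 + a - b) / (2 * (2 + b - 2 * a))) ≤
      b * (3 + a - b) / (2 * (2 + b - 2 * a)) := min_le_right _ _
  have hm1 := hmΨ.trans_eq (e1_eq_psi ha hb).symm
  have hm2 := hmΨ.trans_eq (e2a_eq_psi ha hb).symm
  have hm3 := hmΨ.trans (psi_le_e2b ha hb)
  have hm4 := hmΨ.trans (psi_le_e3 ha hb)
  -- `τ^e ≤ τ^m` for `τ ≤ 1`, `m ≤ e`
  have hpow : ∀ e : ℝ, min b (b * (3 + a - b) / (2 * (2 + b - 2 * a))) ≤ e →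
      (T - t) ^ e ≤ (T - t) ^ min b (b * (3 + a - b) / (2 * (2 + b - 2 * a))) :=
    fun e he => Real.rpow_le_rpow_of_exponent_ge hτ0 hτ1 he
  have hmnn : 0 ≤ (T - t) ^ min b (b * (3 + a - b) / (2 * (2 + b - 2 * a))) :=
    Real.rpow_nonneg hτ0.le _
  have key : ∀ (c e : ℝ), min b (b * (3 + a - b) / (2 * (2 + b - 2 * a))) ≤ e →
      c * (T - t) ^ e ≤ max c 0 * (T - t) ^ min b (b * (3 + a - b) / (2 * (2 + b - 2 * a))) :=
    fun c e he => (mul_le_mul_of_nonneg_right (le_max_left c 0) (Real.rpow_nonneg hτ0.le e)).trans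
      (mul_le_mul_of_nonneg_left (hpow e he) (le_max_right c 0))
  have h0 := key K b hm0
  have h1 := key A₁ _ hm1
  have h2 := key A₂ _ hm2
  have h3 := key A₃ _ hm3
  have h4 := key A₄ _ hm4
  have := hD t ht
  linarith

/-! ### §2 The abstract crossing -/

/-- ★ **Crossing principle**: base `P(b/2)`, a step `P a → P (min b (Ψ a))` valid for `a ∈ [b/2, 1/2]`,
uniform gain `Ψ a ≥ a + γ` there (`γ > 0`), `1/2 < b` ⟹ some exponent `a > 1/2` has `P a` (after at most
`⌈(1−b)/(2 min(γ, b−1/2))⌉` steps). [folklore] -/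
theorem exists_gt_half_of_uniformGain {P : ℝ → Prop} {b γ : ℝ} {Ψ : ℝ → ℝ} (hb : 1 / 2 < b)
    (hγ : 0 < γ) (base : P (b / 2))
    (gain : ∀ a : ℝ, b / 2 ≤ a → a ≤ 1 / 2 → a + γ ≤ Ψ a)
    (step : ∀ a : ℝ, b / 2 ≤ a → a ≤ 1 / 2 → P a → P (min b (Ψ a))) :
    ∃ a : ℝ, 1 / 2 < a ∧ P a := by
  obtain ⟨γ', hγ'⟩ : ∃ γ' : ℝ, γ' = min γ (b - 1 / 2) := ⟨_, rfl⟩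
  have hγ'pos : 0 < γ' := by rw [hγ']; exact lt_min hγ (by linarith)
  have hγ'γ : γ' ≤ γ := by rw [hγ']; exact min_le_left _ _
  have hγ'b : γ' ≤ b - 1 / 2 := by rw [hγ']; exact min_le_right _ _
  have I : ∀ n : ℕ, (∃ a : ℝ, 1 / 2 < a ∧ P a) ∨
      (∃ y : ℝ, b / 2 + n * γ' ≤ y ∧ y ≤ 1 / 2 ∧ P y) := by
    intro n
    induction n with
    | zero =>
      rcases le_or_gt (b / 2) (1 / 2) with h | h
      · exact Or.inr ⟨b / 2, by simp, h, base⟩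
      · exact Or.inl ⟨b / 2, h, base⟩
    | succ n ih =>
      rcases ih with h | ⟨y, hy1, hy2, hPy⟩
      · exact Or.inl h
      · have hy0 : b / 2 ≤ y := by
          have : (0 : ℝ) ≤ n * γ' := mul_nonneg (Nat.cast_nonneg n) hγ'pos.le
          linarith
        have hP' := step y hy0 hy2 hPy
        have hgrow : y + γ' ≤ min b (Ψ y) :=
          le_min (by linarith) ((by linarith : y + γ' ≤ y + γ).trans (gain y hy0 hy2))
        rcases le_or_gt (min b (Ψ y)) (1 / 2) with h' | h'
        · refine Or.inr ⟨min b (Ψ y), ?_, h', hP'⟩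
          have : ((n + 1 : ℕ) : ℝ) * γ' = n * γ' + γ' := by push_cast; ring
          linarith
        · exact Or.inl ⟨_, h', hP'⟩
  obtain ⟨n, hn⟩ := exists_nat_gt ((1 / 2 - b / 2) / γ')
  rcases I n with h | ⟨y, hy1, hy2, hPy⟩
  · exact h
  · exfalso
    have : 1 / 2 - b / 2 < n * γ' := by rwa [div_lt_iff₀ hγ'pos] at hn
    linarith

/-! ### §3 Clock rigidity on U's frame, modulo the one-step schema -/

/-- ★ **No clock of exponent `b ∈ (1/2, 1]` under the mean-field one-step.** On U's frame (maximal smooth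
solution on `[0,T)`, Leray–Hopf on `[0,T]`, decaying datum, tame at `T`), a clock
`∫|u(t)−u(T)|² ≤ K(T−t)^b` with `1/2 < b ≤ 1` TOGETHER WITH the one-step schema at exponent `b` — «an energy
law of exponent `a ∈ [b/2, 1/2]` improves to exponent `min b Ψ_b(a)`» (the ONE inserted antecedent; paper-level:
mean-field proxy, tested identity, Sobolev/interpolation/Hölder, at the balance `μ⋆_b(a) ∈ (0,1]`, exponents
certified in §1) — is contradictory: the free law `b/2` (`energyLaw_of_clock`) crosses `1/2` by
`exists_gt_half_of_uniformGain` + `uniform_gain`, against `EnergyClockScarLaw.no_energyLaw_above_half` (Leray floor file).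
[folklore] -/
theorem no_clock_above_half_of_meanFieldStep :
    ∀ (ν T : ℝ), 0 < ν → 0 < T → ∀ (u : ℝ → EuclideanSpace ℝ (Fin 3) → EuclideanSpace ℝ (Fin 3))
      (p : ℝ → EuclideanSpace ℝ (Fin 3) → ℝ),
      Literature.Analysis.FluidPDE.IsMaximalSmoothSolution ν 0 u p T →
      Literature.Analysis.FluidPDE.IsLerayHopfOn T ν 0 (u 0) u →
      Literature.Analysis.FluidPDE.HasRapidSpatialDecay (u 0) →
      Filter.Tendsto (fun t => MeasureTheory.eLpNorm (u t - u T) 2 MeasureTheory.volume)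
        (nhdsWithin T (Set.Iio T)) (nhds 0) →
      ∀ b : ℝ, 1 / 2 < b → b ≤ 1 →
      (∃ K T₁ : ℝ, T₁ < T ∧ ∀ t ∈ Set.Ioo T₁ T,
        ∫⁻ x, ‖u t x - u T x‖ₑ ^ 2 ≤ ENNReal.ofReal (K * (T - t) ^ b)) →
      (∀ a : ℝ, b / 2 ≤ a → a ≤ 1 / 2 →
        (∃ C T₂ : ℝ, T₂ < T ∧ ∀ t ∈ Set.Ioo T₂ T,
          (∫ x, ‖u t x‖ ^ 2) - ∫ x, ‖u T x‖ ^ 2 ≤ C * (T - t) ^ a) →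
        ∃ C T₂ : ℝ, T₂ < T ∧ ∀ t ∈ Set.Ioo T₂ T,
          (∫ x, ‖u t x‖ ^ 2) - ∫ x, ‖u T x‖ ^ 2 ≤
            C * (T - t) ^ min b (b * (3 + a - b) / (2 * (2 + b - 2 * a)))) →
      False := by
  intro ν T hν hT u p hmax hLH hdec _htame b hb hb1 hclock hstep
  have hbase := EnergyClockScarLaw.energyLaw_of_clock (b := b) ν T hν hT u p hmax.1 hLH hdec hclock
  have hγ : 0 < (b - 1 / 2) * (2 - b) / (2 * (2 + b)) :=
    div_pos (mul_pos (by linarith) (by linarith)) (by linarith)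
  obtain ⟨a, ha, hPa⟩ := exists_gt_half_of_uniformGain
    (P := fun a => ∃ C T₂ : ℝ, T₂ < T ∧ ∀ t ∈ Set.Ioo T₂ T,
      (∫ x, ‖u t x‖ ^ 2) - ∫ x, ‖u T x‖ ^ 2 ≤ C * (T - t) ^ a)
    (Ψ := fun a => b * (3 + a - b) / (2 * (2 + b - 2 * a))) hb hγ hbase
    (fun a hba ha => uniform_gain (by linarith) ha hb.le hb1) hstep
  exact EnergyClockScarLaw.no_energyLaw_above_half ν T hν hT u p hmax hLH hdec a ha hPa

/-- **Clock rigidity `b ≤ 1/2`** (modulo the one-step): on U's frame, tame at `T`, NO clock of exponent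
`b > 1/2` — for `b > 1` unconditionally (`EnergyClockScarLaw.no_clock_above_one`), for `b ∈ (1/2, 1]` granted
the one-step schema at exponent `b`. The sub-cell `{b > 1/2}` of Uᶜ is empty; the clock window of record
`{1/2 ≤ b < 5/8}` collapses to `{b = 1/2}`. [folklore] -/
theorem clockExponent_le_half_of_meanFieldStep :
    ∀ (ν T : ℝ), 0 < ν → 0 < T → ∀ (u : ℝ → EuclideanSpace ℝ (Fin 3) → EuclideanSpace ℝ (Fin 3))
      (p : ℝ → EuclideanSpace ℝ (Fin 3) → ℝ),
      Literature.Analysis.FluidPDE.IsMaximalSmoothSolution ν 0 u p T →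
      Literature.Analysis.FluidPDE.IsLerayHopfOn T ν 0 (u 0) u →
      Literature.Analysis.FluidPDE.HasRapidSpatialDecay (u 0) →
      Filter.Tendsto (fun t => MeasureTheory.eLpNorm (u t - u T) 2 MeasureTheory.volume)
        (nhdsWithin T (Set.Iio T)) (nhds 0) →
      ∀ b : ℝ, 1 / 2 < b →
      (∃ K T₁ : ℝ, T₁ < T ∧ ∀ t ∈ Set.Ioo T₁ T,
        ∫⁻ x, ‖u t x - u T x‖ₑ ^ 2 ≤ ENNReal.ofReal (K * (T - t) ^ b)) →
      (b ≤ 1 → ∀ a : ℝ, b / 2 ≤ a → a ≤ 1 / 2 →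
        (∃ C T₂ : ℝ, T₂ < T ∧ ∀ t ∈ Set.Ioo T₂ T,
          (∫ x, ‖u t x‖ ^ 2) - ∫ x, ‖u T x‖ ^ 2 ≤ C * (T - t) ^ a) →
        ∃ C T₂ : ℝ, T₂ < T ∧ ∀ t ∈ Set.Ioo T₂ T,
          (∫ x, ‖u t x‖ ^ 2) - ∫ x, ‖u T x‖ ^ 2 ≤
            C * (T - t) ^ min b (b * (3 + a - b) / (2 * (2 + b - 2 * a)))) →
      False := by
  intro ν T hν hT u p hmax hLH hdec htame b hb hclock hstep
  rcases le_or_gt b 1 with hb1 | hb1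
  · exact no_clock_above_half_of_meanFieldStep ν T hν hT u p hmax hLH hdec htame b hb hb1 hclock (hstep hb1)
  · exact EnergyClockScarLaw.no_clock_above_one ν T hν hT u p hmax hLH hdec b hb1 hclock

end MeanFieldClockRigidity

end Summit.NavierStokesRegularity.NavierStokesRegularity.Theorems
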